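import Summits.Ventures.HodgeRepro2.T5SU11SphericalLegendreAll
import Summits.Ventures.HodgeRepro2.T5SU11JacobiPhaseLawRateOutside
import Summits.Ventures.HodgeRepro2.T5SU11JacobiParamRecursion

/-!
# The law of the phase at the even integer parameters in closed form: `Φ_{2n+2}(s) = P_n(2e^{2s} − 1)`, and at
`λ = 4`, `λ = 6` the phase is an explicit signed mixture of exponentials

In the phase variable `s = log cosh t` the spherical function of parameter `2n + 2` is the Legendre polynomial
`P_n` at `cosh 2t = 2 cosh² t − 1 = 2e^{2s} − 1` (`T5SU11SphericalLegendreAll`):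

  **`Φ_{2n+2}(s) = P_n(2e^{2s} − 1)`**   (`sphPhase_even`),   `Φ_4(s) = 2e^{2s} − 1`,   `Φ_6(s) = 6e^{4s} − 6e^{2s} + 1`
  (`sphPhase_four`, `sphPhase_six`).

So under `m_k φ_λ dν` the phase `log|a(g)|` has, at `λ = 4`, the density `∝ e^{−(k−2)s}(2e^{2s} − 1) = 2e^{−(k−4)s} − e^{−(k−2)s}`
on `(0, ∞)` — a signed mixture of two exponentials — with the explicit Laplace tails

  **`N_4(a) = ∫_a^∞ e^{−(k−2)s} Φ_4(s) ds = 2e^{−(k−4)a}/(k − 4) − e^{−(k−2)a}/(k − 2)`**   (`tail_four_eq`, `k > 4`),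
  `N_4(0) = k/((k − 4)(k − 2))` (`tail_four_zero`), hence **`m̂_k(4) = 2πk/((k − 4)(k − 2))`** (`jacobi_four_eq`) — in
  agreement with the recursion in the parameter `m̂_k(4) = (k/(k − 4)) m̂_k(2)` of `T5SU11JacobiParamRecursion`
  (`jacobi_four_eq_param_recursion`) — and the tail probability

  **`P_{k,4}(log|a| > a) = (2(k − 2) e^{−(k−4)a} − (k − 4) e^{−(k−2)a})/k`**   (`tail_prob_four_eq`, on the group
  `phase_tail_prob_four_eq`);

at `λ = 6` (`k > 6`): `N_6(a) = 6e^{−(k−6)a}/(k − 6) − 6e^{−(k−4)a}/(k − 4) + e^{−(k−2)a}/(k − 2)` (`tail_six_eq`),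
`m̂_k(6) = 2π (6/(k − 6) − 6/(k − 4) + 1/(k − 2))` (`jacobi_six_eq`). The partial fractions display the poles of the
transform at `k = 2, 4, …, 2n + 2` (`T5SU11SphericalCfun`'s pole statement) with explicit residues. Nothing is
claimed about (N).

Blind lane: Mathlib + the HodgeRepro2 prefix only; no sorry; axioms ⊆ {propext, Classical.choice,
Quot.sound}.
-/

namespace Summit.Ventures.HodgeRepro2.T5SU11JacobiPhaseLawInteger

open MeasureTheory MeasureTheory.Measure Metric Set Filter Topology
open T5SU11Unimodular T5SU11Fibration T5SU11Cartan T5SU11OneParameter T5SU11CartanProjection T5HaarCircle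
  T5BergmanCoefficient T5SU11FibrationHaar T5SU11SphericalFunction T5SU11SphericalSymmetry
  T5SU11SphericalBounds T5SU11SphericalContinuous T5SU11SphericalLegendre T5SU11SphericalLegendreHigher
  T5SU11SphericalLegendreAll T5SU11JacobiLaplacePhase T5SU11JacobiPhaseLipschitz T5SU11JacobiPhaseTailGroup
  T5SU11JacobiPhaseLawRate T5SU11JacobiParamRecursion T5SU11JacobiWeight T5SU11KFiniteMajorantPow
open scoped Real

/-! ### Laplace integrals of exponentials -/

/-- `∫_a^∞ e^{−rs} e^{cs} ds = e^{−(r−c)a}/(r − c)` for `r > c`. -/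
theorem integral_exp_neg_mul_mul_exp_Ioi {r c : ℝ} (h : c < r) (a : ℝ) :
    ∫ s in Ioi a, Real.exp (-(r * s)) * Real.exp (c * s) = Real.exp (-((r - c) * a)) / (r - c) := by
  rw [← integral_exp_neg_mul_Ioi_eq (by linarith : 0 < r - c) a]
  refine setIntegral_congr_fun measurableSet_Ioi fun s _ => ?_
  rw [← Real.exp_add]
  ring_nf

/-- `e^{−rs} e^{cs}` is integrable on `(a, ∞)` for `r > c`. -/
theorem integrableOn_exp_neg_mul_mul_exp_Ioi {r c : ℝ} (h : c < r) (a : ℝ) :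
    IntegrableOn (fun s : ℝ => Real.exp (-(r * s)) * Real.exp (c * s)) (Ioi a) := by
  refine (integrableOn_exp_mul_Ioi (by linarith : -(r - c) < 0) a).congr_fun (fun s _ => ?_) measurableSet_Ioi
  rw [← Real.exp_add]
  ring_nf

section measure

variable [MeasurableSpace Circle] [BorelSpace Circle]

/-! ### The spherical functions of even integer parameter in the phase variable -/

omit [MeasurableSpace Circle] [BorelSpace Circle] in
/-- `cosh(2 t(s)) = 2e^{2s} − 1` for `s ≥ 0`. -/
theorem cosh_two_mul_cartanOfPhase {s : ℝ} (hs : 0 ≤ s) :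
    Real.cosh (2 * cartanOfPhase s) = 2 * Real.exp (2 * s) - 1 := by
  have h2 : Real.exp s ^ 2 = Real.exp (2 * s) := by
    rw [← Real.exp_nat_mul]
    norm_num
  rw [Real.cosh_two_mul, Real.sinh_sq, cosh_cartanOfPhase hs, h2]
  ring

/-- **`Φ_{2n+2}(s) = P_n(2e^{2s} − 1)`** for `s ≥ 0`. -/
theorem sphPhase_even (n : ℕ) {s : ℝ} (hs : 0 ≤ s) :
    sphPhase (2 * (n : ℝ) + 2) s = legP n (2 * Real.exp (2 * s) - 1) := by
  unfold sphPhase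
  rw [sph_even_hyp, cosh_two_mul_cartanOfPhase hs]

/-- **`Φ_4(s) = 2e^{2s} − 1`** for `s ≥ 0`. -/
theorem sphPhase_four {s : ℝ} (hs : 0 ≤ s) : sphPhase 4 s = 2 * Real.exp (2 * s) - 1 := by
  unfold sphPhase
  rw [sph_four_hyp, cosh_two_mul_cartanOfPhase hs]

/-- **`Φ_6(s) = 6e^{4s} − 6e^{2s} + 1`** for `s ≥ 0`. -/
theorem sphPhase_six {s : ℝ} (hs : 0 ≤ s) :
    sphPhase 6 s = 6 * Real.exp (4 * s) - 6 * Real.exp (2 * s) + 1 := by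
  unfold sphPhase
  rw [sph_six_hyp, cosh_two_mul_cartanOfPhase hs, show (4 : ℝ) * s = 2 * s + 2 * s by ring, Real.exp_add]
  ring

/-! ### The second Laplace integral of the Legendre polynomials -/

/-- **Laplace's second integral for `P_n`, read off the definition of the spherical function**:
`P_n(cosh 2t) = ∫_K |cosh t − ū² sinh t|^{−(2n+2)} du` (`du` the normalised Haar measure of the circle) — with
`|cosh t − ū² sinh t|² = cosh 2t − sinh 2t cos 2θ` for `u = e^{iθ}` this is the classical
`P_n(x) = (1/π) ∫_0^π (x − √(x² − 1) cos φ)^{−(n+1)} dφ`. -/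
theorem legP_cosh_eq_integral (n : ℕ) (t : ℝ) :
    legP n (Real.cosh (2 * t))
      = ∫ u, ‖(Real.cosh t : ℂ) - (starRingEnd ℂ) (u : ℂ) ^ 2 * Real.sinh t‖ ^ (-(2 * (n : ℝ) + 2)) ∂haarCircle := by
  rw [← sph_even_hyp, sph_hyp]

/-! ### The Laplace tails at `λ = 4` -/

/-- **`N_4(a) = 2e^{−(k−4)a}/(k − 4) − e^{−(k−2)a}/(k − 2)`** for `k > 4`, `a ≥ 0`. -/
theorem tail_four_eq {k : ℝ} (hk : 4 < k) {a : ℝ} (ha : 0 ≤ a) :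
    ∫ s in Ioi a, Real.exp (-((k - 2) * s)) * sphPhase 4 s
      = 2 * Real.exp (-((k - 4) * a)) / (k - 4) - Real.exp (-((k - 2) * a)) / (k - 2) := by
  have e : ∫ s in Ioi a, Real.exp (-((k - 2) * s)) * sphPhase 4 s
      = ∫ s in Ioi a, (2 * (Real.exp (-((k - 2) * s)) * Real.exp (2 * s)) - Real.exp (-((k - 2) * s))) := by
    refine setIntegral_congr_fun measurableSet_Ioi fun s hs => ?_
    rw [sphPhase_four (le_trans ha (le_of_lt hs))]
    ring
  have i2 := (integrableOn_exp_neg_mul_mul_exp_Ioi (r := k - 2) (c := 2) (by linarith) a).const_mul 2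
  have i0 : IntegrableOn (fun s : ℝ => Real.exp (-((k - 2) * s))) (Ioi a) :=
    integrableOn_exp_neg_mul_mul_exp_Ioi (r := k - 2) (c := 0) (by linarith) a |>.congr_fun
      (fun s _ => by simp) measurableSet_Ioi
  rw [e, integral_sub i2 i0, integral_const_mul,
    integral_exp_neg_mul_mul_exp_Ioi (r := k - 2) (c := 2) (by linarith),
    integral_exp_neg_mul_Ioi_eq (by linarith : (0 : ℝ) < k - 2)]
  ring_nf

/-- **`N_4(0) = k/((k − 4)(k − 2))`** for `k > 4`. -/
theorem tail_four_zero {k : ℝ} (hk : 4 < k) :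
    ∫ s in Ioi (0 : ℝ), Real.exp (-((k - 2) * s)) * sphPhase 4 s = k / ((k - 4) * (k - 2)) := by
  rw [tail_four_eq hk (le_refl 0)]
  simp only [mul_zero, neg_zero, Real.exp_zero]
  have h1 : k - 4 ≠ 0 := by linarith
  have h2 : k - 2 ≠ 0 := by linarith
  field_simp
  ring

/-- **`m̂_k(4) = 2πk/((k − 4)(k − 2))`** for `k > 4`. -/
theorem jacobi_four_eq {k : ℝ} (hk : 4 < k) :
    ∫ g, (1 - ‖orbit g‖ ^ 2) ^ (k / 2) * sph 4 g ∂(nu haarCircle) = 2 * π * (k / ((k - 4) * (k - 2))) := by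
  rw [jacobi_eq_laplace_phase (by linarith) hk (by linarith), tail_four_zero hk]

/-- **Cross-check with the recursion in the parameter**: `m̂_k(4) = (k/(k − 4)) m̂_k(2)` and `m̂_k(2) = 2π/(k − 2)`
give the same value (`T5SU11JacobiParamRecursion.jacobi_param_add_two` at `λ = 2`). -/
theorem jacobi_four_eq_param_recursion {k : ℝ} (hk : 4 < k) :
    ∫ g, (1 - ‖orbit g‖ ^ 2) ^ (k / 2) * sph 4 g ∂(nu haarCircle)
      = (k + 2 - 2) / (k - 2 - 2) * ∫ g, (1 - ‖orbit g‖ ^ 2) ^ (k / 2) * sph 2 g ∂(nu haarCircle) := by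
  have h := jacobi_param_add_two (k := k) (lam := 2) (by linarith) (by linarith) (by linarith)
  rw [show (2 : ℝ) + 2 = 4 by norm_num] at h
  exact h

/-- **The tail probability at `λ = 4`**: `P_{k,4}(log|a| > a) = (2(k − 2)e^{−(k−4)a} − (k − 4)e^{−(k−2)a})/k`. -/
theorem tail_prob_four_eq {k : ℝ} (hk : 4 < k) {a : ℝ} (ha : 0 ≤ a) :
    (∫ s in Ioi a, Real.exp (-((k - 2) * s)) * sphPhase 4 s)
        / ∫ s in Ioi (0 : ℝ), Real.exp (-((k - 2) * s)) * sphPhase 4 s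
      = (2 * (k - 2) * Real.exp (-((k - 4) * a)) - (k - 4) * Real.exp (-((k - 2) * a))) / k := by
  rw [tail_four_eq hk ha, tail_four_zero hk]
  have h1 : k - 4 ≠ 0 := by linarith
  have h2 : k - 2 ≠ 0 := by linarith
  have h3 : k ≠ 0 := by linarith
  field_simp

/-- **On the group**: for `k > 4`, `a ≥ 0`,
`P_{k,4}(log|a(g)| > a) = (2(k − 2)e^{−(k−4)a} − (k − 4)e^{−(k−2)a})/k`. -/
theorem phase_tail_prob_four_eq {k : ℝ} (hk : 4 < k) {a : ℝ} (ha : 0 ≤ a) :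
    (∫ g in {g : SU11 | a < Real.log ‖mat g 0 0‖}, (1 - ‖orbit g‖ ^ 2) ^ (k / 2) * sph 4 g ∂(nu haarCircle))
        / (∫ g, (1 - ‖orbit g‖ ^ 2) ^ (k / 2) * sph 4 g ∂(nu haarCircle))
      = (2 * (k - 2) * Real.exp (-((k - 4) * a)) - (k - 4) * Real.exp (-((k - 2) * a))) / k := by
  rw [integral_phase_tail_eq (by linarith) hk (by linarith) ha, jacobi_eq_laplace_phase (by linarith) hk (by linarith),
    mul_div_mul_left _ _ (by positivity : (2 * π : ℝ) ≠ 0), tail_prob_four_eq hk ha]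

/-! ### The Laplace tails at `λ = 6` -/

/-- **`N_6(a) = 6e^{−(k−6)a}/(k − 6) − 6e^{−(k−4)a}/(k − 4) + e^{−(k−2)a}/(k − 2)`** for `k > 6`, `a ≥ 0`. -/
theorem tail_six_eq {k : ℝ} (hk : 6 < k) {a : ℝ} (ha : 0 ≤ a) :
    ∫ s in Ioi a, Real.exp (-((k - 2) * s)) * sphPhase 6 s
      = 6 * Real.exp (-((k - 6) * a)) / (k - 6) - 6 * Real.exp (-((k - 4) * a)) / (k - 4)
        + Real.exp (-((k - 2) * a)) / (k - 2) := by
  have e : ∫ s in Ioi a, Real.exp (-((k - 2) * s)) * sphPhase 6 s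
      = ∫ s in Ioi a, ((6 * (Real.exp (-((k - 2) * s)) * Real.exp (4 * s))
          - 6 * (Real.exp (-((k - 2) * s)) * Real.exp (2 * s))) + Real.exp (-((k - 2) * s))) := by
    refine setIntegral_congr_fun measurableSet_Ioi fun s hs => ?_
    rw [sphPhase_six (le_trans ha (le_of_lt hs))]
    ring
  have i4 := (integrableOn_exp_neg_mul_mul_exp_Ioi (r := k - 2) (c := 4) (by linarith) a).const_mul 6
  have i2 := (integrableOn_exp_neg_mul_mul_exp_Ioi (r := k - 2) (c := 2) (by linarith) a).const_mul 6
  have i0 : IntegrableOn (fun s : ℝ => Real.exp (-((k - 2) * s))) (Ioi a) :=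
    integrableOn_exp_neg_mul_mul_exp_Ioi (r := k - 2) (c := 0) (by linarith) a |>.congr_fun
      (fun s _ => by simp) measurableSet_Ioi
  have i42 : IntegrableOn (fun s : ℝ => 6 * (Real.exp (-((k - 2) * s)) * Real.exp (4 * s))
      - 6 * (Real.exp (-((k - 2) * s)) * Real.exp (2 * s))) (Ioi a) := i4.sub i2
  rw [e, integral_add i42 i0, integral_sub i4 i2, integral_const_mul, integral_const_mul,
    integral_exp_neg_mul_mul_exp_Ioi (r := k - 2) (c := 4) (by linarith),
    integral_exp_neg_mul_mul_exp_Ioi (r := k - 2) (c := 2) (by linarith),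
    integral_exp_neg_mul_Ioi_eq (by linarith : (0 : ℝ) < k - 2)]
  ring_nf

/-- **`m̂_k(6) = 2π(6/(k − 6) − 6/(k − 4) + 1/(k − 2))`** for `k > 6`. -/
theorem jacobi_six_eq {k : ℝ} (hk : 6 < k) :
    ∫ g, (1 - ‖orbit g‖ ^ 2) ^ (k / 2) * sph 6 g ∂(nu haarCircle)
      = 2 * π * (6 / (k - 6) - 6 / (k - 4) + 1 / (k - 2)) := by
  rw [jacobi_eq_laplace_phase (by linarith) hk (by linarith), tail_six_eq hk (le_refl 0)]
  simp only [mul_zero, neg_zero, Real.exp_zero, mul_one]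

end measure

end Summit.Ventures.HodgeRepro2.T5SU11JacobiPhaseLawInteger
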